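import Literature.AlgebraicGeometry.ShimuraVarieties.UnitaryBallQuotientDatum
import Literature.AlgebraicGeometry.HodgeTheory.RationalHodgeClasses
import Literature.Analysis.Complex.InjectiveHolomorphic
import Mathlib.Analysis.Calculus.InverseFunctionTheorem.FDeriv
import Mathlib.Geometry.Manifold.MFDeriv.Atlas
import Mathlib.Geometry.Manifold.MFDeriv.FDeriv
import Mathlib.Data.Fin.Tuple.Basic
import HarnessLib

/-!
# S2b / A2 — a continuous slice section of the uniformization is holomorphic (Clements–Osgood)

Sub-stub `stub_sectionHolomorphicOfInjOn` (A2) of the construction `stub_heckeGraphAnalytic` of the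
crux `EndoscopicMiddleDegree.OrthogonalEnveloped` (stmt-HodgeConjecture-14300), line
purity-sorted-hecke-envelope.

Let `D` be a ball-quotient datum on `X` (uniformization `unif : cone → X(ℂ)`), `A` a Hodge model of
`X` with comparison homeomorphism `φ = A.toComplexPoints : A.carrier → X(ℂ)`, and assume that
`g = φ⁻¹ ∘ unif` is holomorphic on the (open) negative cone. If `σ` is a continuous section of
`unif` on an open `U ⊆ X(ℂ)` with values in the affine slice `{v | v i = 1}` of an open `V ⊆ cone`,
and `unif` is injective on that slice of `V`, then `σ ∘ φ` is holomorphic on `φ⁻¹ U`.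

Proof. Put `emb u = insertNth i 1 u : ℂᵖ → ℂᵖ⁺¹` and `G = g ∘ emb` on the open set `O = emb⁻¹ V`:
`G` is holomorphic and injective (injectivity of `unif` on the slice) from an open subset of `ℂᵖ`
to the `p`-dimensional complex manifold `A.carrier`, and `τ = removeNth i ∘ σ ∘ φ` is a continuous
right inverse of `G` on `φ⁻¹ U`. In a chart `χ` of `A.carrier` at `a₀`, `T = χ ∘ G` is an
injective holomorphic map between open subsets of `p`-dimensional spaces, so its differential at
`τ a₀` is invertible (Clements–Osgood, Fritzsche–Grauert Thm. I.8.5, the tree's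
`Literature.Analysis.Complex.SCV.bijective_fderiv_of_injOn`) and `T` has a holomorphic local
inverse (inverse function theorem); near `a₀`, `τ = T⁻¹ ∘ χ`, so `τ`, hence `σ ∘ φ = emb ∘ τ`, is
holomorphic at `a₀` (`mdifferentiableAt_of_continuous_rightInverse`).

## References

* K. Fritzsche, H. Grauert, *From Holomorphic Functions to Complex Manifolds*, GTM 213 (2002),
  Ch. I §8, Thm. 8.5 and Cor. 8.6 [FritzscheGrauert2002].
* N. Bergeron, J. Millson, C. Moeglin, *The Hodge conjecture and arithmetic quotients of complex
  balls*, Acta Math. 216 (2016), Part 2 §1.4 [BergeronMillsonMoeglin2016Balls].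
-/

noncomputable section

set_option linter.dupNamespace false

namespace Summit.HodgeConjecture.HodgeConjecture.Cruxes.OrthogonalEnveloped.HeckeGraphChow

open scoped Manifold ContDiff Topology
open Literature.AlgebraicGeometry.Motives (SchemeOver ComplexPoints)
open Literature.AlgebraicGeometry.HodgeTheory (HodgeModel)
open Literature.AlgebraicGeometry.ShimuraVarieties

/-- **Continuous right inverses of injective holomorphic maps into manifolds are holomorphic
(Clements–Osgood).** Let `N` be a complex manifold modelled on `F`, `G : E' → N`
complex-differentiable and injective on an open set `O ⊆ E'`, with `finrank E' = finrank F`. If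
`τ : N → E'` is continuous at `a₀` and, near `a₀`, takes values in `O` with `G (τ a) = a`, then `τ` is
complex-differentiable at `a₀`: in the chart `χ` at `a₀`, `T = χ ∘ G` is injective and holomorphic
on the open set `O ∩ G⁻¹ χ.source`, so `dT(τ a₀)` is invertible (Fritzsche–Grauert Thm. I.8.5) and
`τ = T⁻¹ ∘ χ` near `a₀` for the differentiable local inverse `T⁻¹` of the inverse function
theorem. [cite: FritzscheGrauert2002, Ch. I §8 Cor. 8.6] -/
theorem mdifferentiableAt_of_continuous_rightInverse
    {E' : Type*} [NormedAddCommGroup E'] [NormedSpace ℂ E'] [FiniteDimensional ℂ E']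
    {F : Type*} [NormedAddCommGroup F] [NormedSpace ℂ F] [FiniteDimensional ℂ F]
    {N : Type*} [TopologicalSpace N] [ChartedSpace F N] [IsManifold 𝓘(ℂ, F) 1 N]
    (hdim : Module.finrank ℂ E' = Module.finrank ℂ F) {G : E' → N} {O : Set E'} (hO : IsOpen O)
    (hG : MDifferentiableOn 𝓘(ℂ, E') 𝓘(ℂ, F) G O) (hGinj : Set.InjOn G O) {τ : N → E'} {a₀ : N}
    (hτ : ContinuousAt τ a₀) (hτG : ∀ᶠ a in 𝓝 a₀, τ a ∈ O ∧ G (τ a) = a) :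
    MDifferentiableAt 𝓘(ℂ, F) 𝓘(ℂ, E') τ a₀ := by
  haveI : CompleteSpace E' := FiniteDimensional.complete ℂ E'
  obtain ⟨h₀O, h₀G⟩ := hτG.self_of_nhds
  -- the chart at `a₀` and the injective holomorphic map `T = χ ∘ G` on `O' = O ∩ G⁻¹ χ.source`
  set χ : OpenPartialHomeomorph N F := chartAt F a₀ with hχ
  set O' : Set E' := O ∩ G ⁻¹' χ.source with hO'
  have hO'o : IsOpen O' := hG.continuousOn.isOpen_inter_preimage hO χ.open_source
  set T : E' → F := fun u ↦ χ (G u) with hT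
  have hu₀ : τ a₀ ∈ O' :=
    ⟨h₀O, by rw [Set.mem_preimage, h₀G]; exact mem_chart_source F a₀⟩
  have hTd : DifferentiableOn ℂ T O' := by
    intro u hu
    suffices hd : DifferentiableAt ℂ T u from hd.differentiableWithinAt
    have h1 : MDifferentiableAt 𝓘(ℂ, E') 𝓘(ℂ, F) G u := hG.mdifferentiableAt (hO.mem_nhds hu.1)
    have h2 : MDifferentiableAt 𝓘(ℂ, F) 𝓘(ℂ, F) χ (G u) :=
      mdifferentiableAt_atlas (chart_mem_atlas F a₀) hu.2
    exact mdifferentiableAt_iff_differentiableAt.1 (h2.comp u h1)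
  have hTinj : Set.InjOn T O' := fun u hu u' hu' huu' ↦
    hGinj hu.1 hu'.1 (χ.injOn hu.2 hu'.2 huu')
  -- Clements–Osgood: `dT(τ a₀)` is invertible; inverse function theorem
  have hbij := Literature.Analysis.Complex.SCV.bijective_fderiv_of_injOn hdim hTd hO'o hTinj hu₀
  set Λ : E' ≃L[ℂ] F := ContinuousLinearEquiv.ofBijective (fderiv ℂ T (τ a₀))
    (LinearMap.ker_eq_bot.2 hbij.1) (LinearMap.range_eq_top.2 hbij.2) with hΛ
  have hstrict : HasStrictFDerivAt T (Λ : E' →L[ℂ] F) (τ a₀) := by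
    rw [hΛ, ContinuousLinearEquiv.coe_ofBijective]
    exact ((Literature.Analysis.Complex.SCV.contDiffOn_one hTd hO'o).contDiffAt
      (hO'o.mem_nhds hu₀)).hasStrictFDerivAt one_ne_zero
  have hTa₀ : T (τ a₀) = χ a₀ := by simp only [hT, h₀G]
  -- near `a₀`, `τ = T⁻¹ ∘ χ`
  have hev : τ =ᶠ[𝓝 a₀] fun a ↦ hstrict.localInverse T _ _ (χ a) := by
    have h2 : ∀ᶠ a in 𝓝 a₀, hstrict.localInverse T _ _ (T (τ a)) = τ a :=
      hτ.eventually hstrict.eventually_left_inverse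
    filter_upwards [hτG, h2] with a ha ha2
    have hTa : T (τ a) = χ a := by simp only [hT, ha.2]
    rw [hTa] at ha2
    exact ha2.symm
  refine MDifferentiableAt.congr_of_eventuallyEq ?_ hev
  have h1 : MDifferentiableAt 𝓘(ℂ, F) 𝓘(ℂ, E') (hstrict.localInverse T _ _) (χ a₀) := by
    rw [← hTa₀]
    exact mdifferentiableAt_iff_differentiableAt.2
      hstrict.to_localInverse.hasFDerivAt.differentiableAt
  have h2 : MDifferentiableAt 𝓘(ℂ, F) 𝓘(ℂ, F) χ a₀ :=
    mdifferentiableAt_atlas (chart_mem_atlas F a₀) (mem_chart_source F a₀)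
  exact h1.comp a₀ h2

/-- **Stub A2 (`stub_sectionHolomorphicOfInjOn`) — a continuous slice section of `unif` is holomorphic in the
Hodge model (Clements–Osgood).** GRANTED Stub B: if `σ` is continuous on the open `U ⊆ X(ℂ)` with values in the
slice `{v i = 1}` of an open `V ⊆ cone`, `unif ∘ σ = id` on `U`, and `unif` is injective on `V ∩ {v i = 1}`,
then `σ ∘ A.toComplexPoints` is holomorphic on `A.toComplexPoints⁻¹ U`: the map
`u ↦ A.toComplexPoints⁻¹ (unif (insertNth i 1 u))` is an injective holomorphic map from an open subset of `ℂᵖ`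
to the `p`-dimensional manifold `A.carrier`, and `removeNth i ∘ σ ∘ A.toComplexPoints` is a continuous right
inverse of it, hence holomorphic (`mdifferentiableAt_of_continuous_rightInverse`); composing with the affine
map `insertNth i 1` gives back `σ ∘ A.toComplexPoints`.
[cite: FritzscheGrauert2002, Ch. I §8 Thm. 8.5 and Cor. 8.6] -/
theorem stub_sectionHolomorphicOfInjOn :
    ∀ {p : ℕ} {X : SchemeOver ℂ} (D : UnitaryBallQuotientDatum p X) (A : HodgeModel p X),
      MDifferentiableOn 𝓘(ℂ, Fin (p + 1) → ℂ) 𝓘(ℂ, A.model)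
        (fun v ↦ A.isAnalytification.isHomeomorph.homeomorph.symm (D.unif v)) D.cone →
      ∀ (U : Set (ComplexPoints X)) (σ : ComplexPoints X → (Fin (p + 1) → ℂ)) (i : Fin (p + 1))
        (V : Set (Fin (p + 1) → ℂ)),
        IsOpen U → ContinuousOn σ U → IsOpen V → V ⊆ D.cone →
        (∀ Q ∈ U, σ Q ∈ V ∧ σ Q i = 1 ∧ D.unif (σ Q) = Q) →
        Set.InjOn D.unif {v ∈ V | v i = 1} →
        MDifferentiableOn 𝓘(ℂ, A.model) 𝓘(ℂ, Fin (p + 1) → ℂ) (σ ∘ A.toComplexPoints)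
          (A.toComplexPoints ⁻¹' U) := by
  intro p X D A hg U σ i V hU hσ hV hVc hsec hinj
  haveI : IsManifold 𝓘(ℂ, A.model) 1 A.carrier := inferInstance
  set φ : A.carrier → ComplexPoints X := A.toComplexPoints with hφ
  have hφc : Continuous φ := A.isAnalytification.isHomeomorph.continuous
  set e : A.carrier ≃ₜ ComplexPoints X := A.isAnalytification.isHomeomorph.homeomorph with he
  have hsymm : ∀ a, e.symm (φ a) = a := fun a ↦ e.symm_apply_apply a
  -- the affine slice embedding `emb : ℂᵖ → {v | v i = 1} ⊆ ℂᵖ⁺¹`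
  set emb : (Fin p → ℂ) → (Fin (p + 1) → ℂ) := fun u ↦ Fin.insertNth i (1 : ℂ) u with hemb
  have hemb_d : Differentiable ℂ emb := by
    refine differentiable_pi.2 fun j ↦ ?_
    rcases Fin.eq_self_or_eq_succAbove i j with hji | ⟨k, rfl⟩
    · rw [hji]
      simp only [hemb, Fin.insertNth_apply_same]
      exact differentiable_const _
    · simp only [hemb, Fin.insertNth_apply_succAbove]
      exact differentiable_apply k
  have hemb_i : ∀ u, emb u i = 1 := fun u ↦ Fin.insertNth_apply_same i _ _
  have hemb_prj : ∀ v : Fin (p + 1) → ℂ, v i = 1 → emb (Fin.removeNth i v) = v :=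
    fun v hv ↦ Fin.insertNth_eq_iff.2 ⟨hv.symm, rfl⟩
  -- `G = φ⁻¹ ∘ unif ∘ emb` is holomorphic and injective on the open set `O = emb⁻¹ V`
  set O : Set (Fin p → ℂ) := emb ⁻¹' V with hO
  have hOo : IsOpen O := hV.preimage hemb_d.continuous
  set G : (Fin p → ℂ) → A.carrier := fun u ↦ e.symm (D.unif (emb u)) with hG
  have hGd : MDifferentiableOn 𝓘(ℂ, Fin p → ℂ) 𝓘(ℂ, A.model) G O := by
    intro u hu
    have h1 : MDifferentiableAt 𝓘(ℂ, Fin (p + 1) → ℂ) 𝓘(ℂ, A.model)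
        (fun v ↦ e.symm (D.unif v)) (emb u) :=
      hg.mdifferentiableAt ((isOpen_negCone D.Hℂ).mem_nhds (hVc hu))
    exact (h1.comp u (hemb_d u).mdifferentiableAt).mdifferentiableWithinAt
  have hGinj : Set.InjOn G O := by
    intro u hu u' hu' huu'
    have h1 : D.unif (emb u) = D.unif (emb u') := e.symm.injective huu'
    have h2 : emb u = emb u' := hinj ⟨hu, hemb_i u⟩ ⟨hu', hemb_i u'⟩ h1
    exact (Fin.insertNth_inj.1 h2).2
  have hdim : Module.finrank ℂ (Fin p → ℂ) = Module.finrank ℂ A.model := by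
    rw [Module.finrank_fin_fun ℂ, A.isAnalytification.finrank_eq]
  -- pointwise on the open set `φ⁻¹ U`
  have hUo : IsOpen (φ ⁻¹' U) := hU.preimage hφc
  intro a₀ ha₀
  suffices h : MDifferentiableAt 𝓘(ℂ, A.model) 𝓘(ℂ, Fin (p + 1) → ℂ) (σ ∘ φ) a₀ from
    h.mdifferentiableWithinAt
  -- `τ = removeNth i ∘ σ ∘ φ` is a continuous right inverse of `G` near `a₀`
  set τ : A.carrier → (Fin p → ℂ) := fun a ↦ Fin.removeNth i (σ (φ a)) with hτ
  have hprj : Continuous fun v : Fin (p + 1) → ℂ ↦ (Fin.removeNth i v : Fin p → ℂ) :=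
    continuous_pi fun j ↦ continuous_apply (i.succAbove j)
  have hτc : ContinuousAt τ a₀ :=
    hprj.continuousAt.comp ((hσ.continuousAt (hU.mem_nhds ha₀)).comp hφc.continuousAt)
  have hστ : ∀ a ∈ φ ⁻¹' U, σ (φ a) = emb (τ a) := fun a ha ↦
    (hemb_prj (σ (φ a)) (hsec (φ a) ha).2.1).symm
  have hτG : ∀ᶠ a in 𝓝 a₀, τ a ∈ O ∧ G (τ a) = a := by
    filter_upwards [hUo.mem_nhds ha₀] with a ha
    refine ⟨?_, ?_⟩
    · show emb (τ a) ∈ V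
      rw [← hστ a ha]
      exact (hsec (φ a) ha).1
    · show e.symm (D.unif (emb (τ a))) = a
      rw [← hστ a ha, (hsec (φ a) ha).2.2]
      exact hsymm a
  have hτd : MDifferentiableAt 𝓘(ℂ, A.model) 𝓘(ℂ, Fin p → ℂ) τ a₀ :=
    mdifferentiableAt_of_continuous_rightInverse hdim hOo hGd hGinj hτc hτG
  -- `σ ∘ φ = emb ∘ τ` near `a₀`
  have hev : σ ∘ φ =ᶠ[𝓝 a₀] emb ∘ τ := by
    filter_upwards [hUo.mem_nhds ha₀] with a ha
    exact hστ a ha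
  exact ((hemb_d (τ a₀)).mdifferentiableAt.comp a₀ hτd).congr_of_eventuallyEq hev

end Summit.HodgeConjecture.HodgeConjecture.Cruxes.OrthogonalEnveloped.HeckeGraphChow

end
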